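/-
Copyright (c) 2026 the pub-hodgecm-mathlib formalisation cell (harness21).  Prover seat hodgecm-mathlib-A-p19 (g25): T3′ organ «ROW-2, ONE-PLACE FORM» (road
«S3-tree», crux H413) — the parity dichotomy for the count of self-dual `τ`-cyclic lattices, over ★ O8a-4 ∕ O8a-1 ∕ O8a-∃.
-/
import Literature.NumberTheory.Automorphic.SplitTorusOrderCountTransport     -- ★ p845615 O8a-4: `ncard_setOf_selfDual_cyclic_eq_natCard_good` (⇒ ★ O8a-3 `valuation_eq_one_iff_exists_mul_eq_one`)
import Literature.NumberTheory.Automorphic.SplitTorusOrderComposedIndex      -- ★ p846159 O8a-5Σ: `apply_mem_integer_of_mem_adjoin` (⇒ ★ O8a-1 `natCard_setOf_cyclicLattice_good_eq_relIndex`, `aeval_pi_apply`)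
import Literature.NumberTheory.Automorphic.SplitTorusOrderNormCriterion       -- ★ p845516 O8a-∃: `exists_criterion_of_norm_solutions`, `isUnit_normSymm_of_criterion`, `symmProd_fixed`, …
import HarnessLib

/-!
# Self-dual `τ`-cyclic lattices: the parity dichotomy `#{…} = [C : R^×]` or `0`

Topic `NumberTheory/Automorphic`; namespace `Literature.NumberTheory.Automorphic`.  THEOREMS ONLY (no definition, no instance, no notation, no named
fact, no `sorry`); kernel lane `--supports stmt-HodgeConjecture-24833` (road «S3-tree», T3′ «DEPTH-ZERO κ-TRANSFER», P-1 row (ii) in one-place form).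

(D0) currency of ★ O8a-1∕O8a-3∕O8a-4∕O8a-∃: a valued field `E` (`[ValuativeRel E]`, a non-archimedean local field where Hensel is used) with an involution
`σ` preserving `𝒪 = 𝒪[E]` and moving some integer by a unit (the inert dictionary `hσσ hσO hmove hσv` of ★ Σ2-F∕Σ2-CM), `2 ∈ 𝒪^×`, a `σ`-fixed `ϖ ≠ 0`;
a `σ`-hermitian `J ∈ GL_n(𝒪)`; DEEP norm-one nodes `γ_i ∈ 𝒪` (`σγ_i = γ_i⁻¹`, `|γ_i − 1| < 1`, pairwise distinct); an eigenframe `P` with diagonal Gram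
`formCongr σ P J = diag(d)`, `σ d_i = d_i`; `τ := P·diag(γ)·P⁻¹`.  The set counted is ★ O8a-4's
`S(τ) = {Λ | (∃ u ∈ U(σ,J), Λ = Λ(u)) ∧ ∃ w, Λ = span_𝒪 {τ^j w}}` (= A-p12's regular-nilpotent stratum of `Fix_τ`, ★ `ncard_fixedBy_unitary_rank_eq_ncard_free′`).

**Contents.**
* §1 `exists_poly_eval_mul_eq_one` — units `γ_i` of `𝒪` have ONE `r ∈ 𝒪[X]` with `r(γ_i) γ_i = 1` (`r := −c₀⁻¹ · (∏ (X − γ_i)).divX`): the `hr` input of ★ O8a-3∕O8a-4.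
* §2 `map_mem_adjoin_of_map_eq_inv` — `𝒪[γ]` is `σ`-stable when `σγ_i = γ_i⁻¹ = r(γ_i)` (the `hσγ` input of ★ Σ2-F (c) ∕ O8a-5Σ).
* §3 the criterion scalars `c_i := d_i ∏_{j≠i} (γ_i − γ_j)`: `valuation_criterion_eq` (a GOOD `a` forces `|c_i| = |a_i σ a_i|⁻¹ · 1`), and the two halves of the
  dichotomy: **`ncard_setOf_selfDual_cyclic_eq_relIndex_of_even`** (`|c_i| = |ϖ|^{2k_i}` for all `i` ⇒ `#S(τ) = [C : R^×]`, ★ O8a-∃ norm solutions + ★ O8a-1) and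
  **`ncard_setOf_selfDual_cyclic_eq_zero_of_odd`** (`|c_i| = |ϖ|^{2k+1}` for some `i`, odd powers of `ϖ` not norm values ⇒ `S(τ) = ∅`, ★ O8a-∃ converse).

HONEST LABEL: HC_CM is proved only modulo the 2 remaining named inputs (hLiu418 24832, h413 24833) until rung 0 closes; this file is count-neutral.

## References
* [Jacobowitz1962] R. Jacobowitz, *Hermitian forms over local fields*, Amer. J. Math. 84 (1962), §4, §7 Thm. 7.1 (unimodular lattices, norms at an unramified extension).
* [Rogawski1990] J. D. Rogawski, *Automorphic Representations of Unitary Groups in Three Variables* (1990), §4.9 Lemma 4.9.3 p. 56 (the count).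
* [Serre1979] J.-P. Serre, *Local Fields*, GTM 67 (1979), Ch. V §2 Prop. 3 (norms of units at an unramified extension).
-/

set_option autoImplicit false

open Polynomial Finset Matrix
open scoped ValuativeRel Matrix MatrixGroups
open ValuativeRel

namespace Literature.NumberTheory.Automorphic

open Literature.NumberTheory.Automorphic.UnitaryGroup

/-! ## §1 One polynomial inverting all the nodes -/

section Poly

variable {K : Type*} [Field K] {n : ℕ} (O : Subring K)

/-- **Units `γ_i` of `O` have a common polynomial inverse**: `r ∈ O[X]` with `r(γ_i) · γ_i = 1` for all `i` — with `p = ∏ (X − γ_i) = X·p.divX + c₀`,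
`c₀ = ∏(−γ_i) ∈ O^×`, take `r = −c₀⁻¹ · p.divX`.  (The `hr` input of ★ O8a-3∕O8a-4: `γ⁻¹ ∈ O[γ]`.) [cite: Serre1979, Ch. III §6] -/
theorem exists_poly_eval_mul_eq_one {γ : Fin n → K} (hγ : ∀ i, γ i ∈ O) (hγu : ∀ i, ∃ y ∈ O, y * γ i = 1) :
    ∃ r : O[X], ∀ i, (r.map O.subtype).eval (γ i) * γ i = 1 := by
  classical
  choose y hyO hy using hγu
  set γO : Fin n → O := fun i => ⟨γ i, hγ i⟩ with hγO
  set p : O[X] := ∏ i, (X - C (γO i)) with hp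
  -- the constant term and its inverse
  set c₀ : O := p.coeff 0 with hc₀
  set c₀' : O := ∏ i, (-(⟨y i, hyO i⟩ : O)) with hc₀'
  have hc₀val : c₀ = ∏ i, (-γO i) := by
    rw [hc₀, Polynomial.coeff_zero_eq_eval_zero, hp, Polynomial.eval_prod]
    simp
  have hinv : c₀' * c₀ = 1 := by
    rw [hc₀val, hc₀', ← Finset.prod_mul_distrib]
    refine Finset.prod_eq_one fun i _ => ?_
    rw [neg_mul_neg]
    exact Subtype.ext (by simp [hγO, hy i])
  refine ⟨C (-c₀') * p.divX, fun i => ?_⟩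
  -- `p(γ_i) = 0`
  have hroot : (p.map O.subtype).eval (γ i) = 0 := by
    rw [hp, Polynomial.map_prod, Polynomial.eval_prod]
    refine Finset.prod_eq_zero (Finset.mem_univ i) ?_
    simp [hγO]
  -- `p = divX p * X + C c₀`
  have hdiv : (p.divX * X + C c₀).map O.subtype = p.map O.subtype := by rw [hc₀, Polynomial.divX_mul_X_add]
  have heval := congrArg (fun q => q.eval (γ i)) hdiv
  simp only [Polynomial.map_add, Polynomial.map_mul, Polynomial.map_X, Polynomial.map_C, Polynomial.eval_add, Polynomial.eval_mul,
    Polynomial.eval_X, Polynomial.eval_C, hroot] at heval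
  -- `heval : divX p (γ i) * γ i + c₀ = 0`
  have hc : (O.subtype c₀' : K) * O.subtype c₀ = 1 := by rw [← map_mul, hinv, map_one]
  rw [Polynomial.map_mul, Polynomial.map_C, Polynomial.eval_mul, Polynomial.eval_C, map_neg]
  linear_combination (-(O.subtype c₀' : K)) * heval + hc

end Poly

/-! ## §2 `σ`-stability of the order `𝒪[γ]` -/

section Stable

variable {E : Type*} [Field E] [ValuativeRel E] {n : ℕ} (σ : E →+* E)

/-- **`𝒪[γ]` is `σ`-stable** when `σ` preserves `𝒪` and `σ(γ_i) = γ_i⁻¹ = r(γ_i)` for one `r ∈ 𝒪[X]` (the `hσγ` input of ★ Σ2-F (c) ∕ ★ O8a-5Σ: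
`σ(p(γ)) = (σp)(r(γ)) ∈ 𝒪[γ]`). [cite: Serre1979, Ch. III §6] -/
theorem map_mem_adjoin_of_map_eq_inv (hσO : ∀ x : 𝒪[E], σ x ∈ 𝒪[E]) {γ : Fin n → E} (hσγ : ∀ i, σ (γ i) = (γ i)⁻¹)
    {r : (𝒪[E])[X]} (hr : ∀ i, (r.map (𝒪[E]).subtype).eval (γ i) * γ i = 1)
    {x : Fin n → E} (hx : x ∈ Algebra.adjoin 𝒪[E] ({γ} : Set (Fin n → E))) :
    (fun i => σ (x i)) ∈ Algebra.adjoin 𝒪[E] ({γ} : Set (Fin n → E)) := by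
  induction hx using Algebra.adjoin_induction with
  | mem y hy =>
    rw [Set.mem_singleton_iff] at hy
    rw [hy]
    have hγ0 : ∀ i, γ i ≠ 0 := fun i h0 => by simpa [h0] using hr i
    have heq : (fun i => σ (γ i)) = (aeval γ r : Fin n → E) := by
      funext i
      rw [aeval_pi_apply 𝒪[E] γ r i, hσγ i]
      exact (eq_inv_of_mul_eq_one_left (hr i)).symm
    rw [heq]
    exact Polynomial.aeval_mem_adjoin_singleton 𝒪[E] γ
  | algebraMap c =>
    have heq : (fun i => σ ((algebraMap 𝒪[E] (Fin n → E) c) i)) = algebraMap 𝒪[E] (Fin n → E) ⟨σ c, hσO c⟩ := by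
      funext i; rfl
    rw [heq]
    exact Subalgebra.algebraMap_mem _ _
  | add y z _ _ hy hz =>
    have heq : (fun i => σ ((y + z) i)) = (fun i => σ (y i)) + fun i => σ (z i) := by funext i; simp [map_add]
    rw [heq]; exact add_mem hy hz
  | mul y z _ _ hy hz =>
    have heq : (fun i => σ ((y * z) i)) = (fun i => σ (y i)) * fun i => σ (z i) := by funext i; simp [map_mul]
    rw [heq]; exact mul_mem hy hz

end Stable

/-! ## §3 The criterion scalars and the parity dichotomy -/

section Parity

variable {E : Type*} [Field E] [ValuativeRel E] {n : ℕ} (σ : E →+* E)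

/-- Deep nodes are non-zero and `1 + γ_i` is a unit of `𝒪` (`2 ∈ 𝒪^×`, `|γ_i − 1| < 1`). [cite: Serre1979, Ch. II §1] -/
theorem exists_mul_one_add_eq_one_of_deep (h2 : IsUnit (2 : 𝒪[E])) {γ : Fin n → E} (hγ : ∀ i, γ i ∈ 𝒪[E])
    (hγ1 : ∀ i, valuation E (γ i - 1) < 1) (i : Fin n) : ∃ y ∈ 𝒪[E], y * (1 + γ i) = 1 := by
  -- `1 + γ_i = 2 + (γ_i − 1)` with `2` a unit and `γ_i − 1 ∈ 𝓂`
  have hmem : (1 : E) + γ i ∈ 𝒪[E] := add_mem (one_mem _) (hγ i)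
  rw [← valuation_eq_one_iff_exists_mul_eq_one hmem]
  have h2v : valuation E (2 : E) = 1 := by
    have e2 : ((2 : 𝒪[E]) : E) = 2 := map_ofNat (𝒪[E]).subtype 2
    rw [← e2]
    exact (Valuation.integer.integers (valuation E)).valuation_unit h2.unit
  have hsum : (1 : E) + γ i = 2 + (γ i - 1) := by ring
  rw [hsum, Valuation.map_add_eq_of_lt_left _ (by rw [h2v]; exact hγ1 i), h2v]

/-- The units of `𝒪` have valuation `1` (`∃ y ∈ 𝒪, y t = 1` form). [cite: Serre1979, Ch. II §1] -/
theorem valuation_eq_one_of_exists_mul_eq_one {t : E} (ht : t ∈ 𝒪[E]) (h : ∃ y ∈ 𝒪[E], y * t = 1) : valuation E t = 1 :=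
  (valuation_eq_one_iff_exists_mul_eq_one ht).2 h

/-- **A GOOD `a` PRICES THE CRITERION SCALARS AS NORMS**: if the criterion vector `(d_i a_i σ(a_i) f′(γ_i))_i` of ★ O8a-1 lies in `span_𝒪{γ^j}` with unit
components, then `|d_i f′(γ_i)| · |a_i σ(a_i)| = 1` for every `i` (`f′(γ_i) = ∏_{j≠i} (γ_i − γ_j)`). [cite: Jacobowitz1962, §7 Thm. 7.1] -/
theorem valuation_criterion_mul_norm_eq_one {γ : Fin n → E} (hγ : ∀ i, γ i ∈ 𝒪[E]) (d a : Fin n → E)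
    (hmem : (fun i => d i * a i * σ (a i) * ∏ j ∈ univ.erase i, (γ i - γ j)) ∈
      Submodule.span 𝒪[E] (Set.range fun j : Fin n => fun i => γ i ^ (j : ℕ)))
    (hunit : ∀ i, ∃ y ∈ 𝒪[E], y * (d i * a i * σ (a i) * ∏ j ∈ univ.erase i, (γ i - γ j)) = 1) (i : Fin n) :
    valuation E (d i * ∏ j ∈ univ.erase i, (γ i - γ j)) * valuation E (a i * σ (a i)) = 1 := by
  have hO : d i * a i * σ (a i) * ∏ j ∈ univ.erase i, (γ i - γ j) ∈ 𝒪[E] :=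
    apply_mem_integer_of_mem_adjoin hγ ((mem_adjoin_singleton_iff_mem_span_pow 𝒪[E] hγ _).2 hmem) i
  have h1 := valuation_eq_one_of_exists_mul_eq_one hO (hunit i)
  rw [← map_mul, ← h1]
  congr 1
  ring

variable [UniformSpace E] [IsUniformAddGroup E] [IsNonarchimedeanLocalField E]

/-- **THE EVEN HALF: `#S(τ) = [C : R^×]`.**  If every criterion scalar has the valuation of an EVEN power of `ϖ` (`|d_i f′(γ_i)| = |ϖ|^{2k_i}`), a GOOD `a₀` exists
(★ O8a-∃: symmetrise by the skew unit `δ`, solve `a_i σ(a_i) c_i = 1` by ★ `exists_norm_solution_of_zpow_even`), and ★ O8a-4 ∘ ★ O8a-1 count the set.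
[cite: Jacobowitz1962, §7 Thm. 7.1] [cite: Serre1979, Ch. V §2 Prop. 3] [cite: Rogawski1990, §4.9 Lemma 4.9.3 p. 56] -/
theorem ncard_setOf_selfDual_cyclic_eq_relIndex_of_even (hσσ : ∀ x, σ (σ x) = x) (hσO : ∀ x : 𝒪[E], σ x ∈ 𝒪[E])
    (hmove : ∃ a : 𝒪[E], IsUnit ((⟨σ a, hσO a⟩ : 𝒪[E]) - a)) (hσv : ∀ x, valuation E (σ x) = valuation E x)
    (h2 : IsUnit (2 : 𝒪[E])) (δ : 𝒪[E]) (hδ : IsUnit δ) (hσδ : σ (δ : E) = -(δ : E)) {ϖ : E} (hϖ0 : ϖ ≠ 0) (hσϖ : σ ϖ = ϖ)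
    (J : GL (Fin n) E) (hJ : J ∈ glInt n E) (hJh : ((J : Matrix (Fin n) (Fin n) E).map σ)ᵀ = J)
    (P : GL (Fin n) E) (d : Fin n → E) (hP : formCongr σ P (J : Matrix (Fin n) (Fin n) E) = diagonal d) (hσd : ∀ i, σ (d i) = d i)
    {γ : Fin n → E} (hγ : ∀ i, γ i ∈ 𝒪[E]) (hinj : Function.Injective γ) (hσγ : ∀ i, σ (γ i) = (γ i)⁻¹)
    (hγ1 : ∀ i, valuation E (γ i - 1) < 1)
    (hev : ∀ i, ∃ k : ℤ, valuation E (d i * ∏ j ∈ univ.erase i, (γ i - γ j)) = valuation E (ϖ ^ (2 * k))) :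
    {Λ : Submodule 𝒪[E] (Fin n → E) |
        (∃ u ∈ unitaryGroupOfForm σ (J : Matrix (Fin n) (Fin n) E), Λ = Submodule.span 𝒪[E] (Set.range ((u : Matrix (Fin n) (Fin n) E))ᵀ)) ∧
        ∃ w : Fin n → E, Λ = Submodule.span 𝒪[E] (Set.range fun j : Fin n =>
          ((P : Matrix (Fin n) (Fin n) E) * diagonal γ * ((P⁻¹ : GL (Fin n) E) : Matrix (Fin n) (Fin n) E)) ^ (j : ℕ) *ᵥ w)}.ncard =
      ((Algebra.adjoin 𝒪[E] ({γ} : Set (Fin n → E))).toSubmonoid.units).relIndex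
        (((Algebra.adjoin 𝒪[E] ({γ} : Set (Fin n → E))).toSubmonoid.units).comap
          (MonoidHom.id (Fin n → E)ˣ * (Units.map (RingHom.pi fun i : Fin n => σ.comp (Pi.evalRingHom (fun _ : Fin n => E) i)).toMonoidHom))) := by
  classical
  -- the dictionary inputs of ★ O8a-4
  have hγ0 : ∀ i, γ i ≠ 0 := fun i h0 => by
    have := hγ1 i; rw [h0, zero_sub, Valuation.map_neg, map_one] at this; exact lt_irrefl _ this
  have hγu : ∀ i, ∃ y ∈ 𝒪[E], y * γ i = 1 := fun i => ⟨σ (γ i), hσO ⟨γ i, hγ i⟩, by rw [hσγ i, inv_mul_cancel₀ (hγ0 i)]⟩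
  obtain ⟨r, hr⟩ := exists_poly_eval_mul_eq_one 𝒪[E] hγ hγu
  have h20 : (2 : E) ≠ 0 := by
    intro h
    have e2 : ((2 : 𝒪[E]) : E) = 2 := map_ofNat (𝒪[E]).subtype 2
    exact h2.ne_zero (Subtype.ext (by rw [e2, h]; rfl))
  have e2 : ((2 : 𝒪[E]) : E) = 2 := map_ofNat (𝒪[E]).subtype 2
  have htr : ∃ b : 𝒪[E], (b : E) + σ b = 1 := by
    refine ⟨↑(h2.unit⁻¹), ?_⟩
    have hb : (2 : E) * ((↑(h2.unit⁻¹) : 𝒪[E]) : E) = 1 := by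
      have h' := congrArg (fun z : 𝒪[E] => (z : E)) h2.mul_val_inv
      simp only [MulMemClass.coe_mul, OneMemClass.coe_one, e2] at h'
      exact h'
    have hσb : σ (((↑(h2.unit⁻¹) : 𝒪[E]) : E)) = ((↑(h2.unit⁻¹) : 𝒪[E]) : E) := by
      have h' := congrArg σ hb
      rw [map_mul, map_ofNat, map_one] at h'
      exact mul_left_cancel₀ h20 (h'.trans hb.symm)
    rw [hσb]; linear_combination hb
  have hnorm : ∀ u : 𝒪[E], IsUnit u → σ u = u → ∃ t : 𝒪[E], (t : E) * σ t = u := fun u hu hσu =>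
    LocalFields.UnramifiedQuadraticNorm.exists_mul_map_eq_of_isUnit_integer σ hσσ hσO hmove u hu hσu
  rw [ncard_setOf_selfDual_cyclic_eq_natCard_good σ hσσ hσO htr hnorm hσv J hJ hJh P d hP hγ hinj hσγ hr]
  -- a GOOD `a₀` from the norm solutions (★ O8a-∃)
  have hγ1u := exists_mul_one_add_eq_one_of_deep h2 hγ hγ1
  obtain ⟨hδ0, hδinv⟩ := Literature.RingTheory.GaloisAlgebras.coe_ne_zero_and_inv_mem_of_isUnit 𝒪[E] hδ
  have hδu : ∃ y ∈ 𝒪[E], y * (δ : E) = 1 := ⟨(δ : E)⁻¹, hδinv, inv_mul_cancel₀ hδ0⟩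
  -- the symmetrised scalars `c_i = d_i · ∏ (γ_i − γ_j)/((1+γ_i)(1+γ_j)δ)` are `σ`-fixed with the valuation of `d_i f′(γ_i)`
  have hsol : ∀ i, ∃ b : E, b * σ b * (d i * ∏ j ∈ univ.erase i, (γ i - γ j) / ((1 + γ i) * (1 + γ j) * δ)) = 1 := by
    intro i
    obtain ⟨k, hk⟩ := hev i
    have hσc : σ (d i * ∏ j ∈ univ.erase i, (γ i - γ j) / ((1 + γ i) * (1 + γ j) * δ)) =
        d i * ∏ j ∈ univ.erase i, (γ i - γ j) / ((1 + γ i) * (1 + γ j) * δ) := by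
      rw [map_mul, hσd i, symmProd_fixed σ hσγ hγ0 hσδ i]
    -- valuation: the unit factor `∏ ((1+γ_i)(1+γ_j)δ)`
    obtain ⟨y, hyO, hy⟩ := symmFactor_units 𝒪[E] hγ hγ1u δ.2 hδu i
    have hγ1' : ∀ j, 1 + γ j ≠ 0 := fun j h0 => by
      obtain ⟨z, _, hz⟩ := hγ1u j; rw [h0, mul_zero] at hz; exact zero_ne_one hz
    have hF : valuation E (∏ j ∈ univ.erase i, ((1 + γ i) * (1 + γ j) * (δ : E))) = 1 := by
      refine valuation_eq_one_of_exists_mul_eq_one ?_ ⟨y, hyO, hy⟩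
      exact prod_mem fun j _ => mul_mem (mul_mem (add_mem (one_mem _) (hγ i)) (add_mem (one_mem _) (hγ j))) δ.2
    have hval : valuation E (d i * ∏ j ∈ univ.erase i, (γ i - γ j) / ((1 + γ i) * (1 + γ j) * δ)) = valuation E (ϖ ^ (2 * k)) := by
      have heq : d i * ∏ j ∈ univ.erase i, (γ i - γ j) =
          (d i * ∏ j ∈ univ.erase i, (γ i - γ j) / ((1 + γ i) * (1 + γ j) * δ)) * ∏ j ∈ univ.erase i, ((1 + γ i) * (1 + γ j) * (δ : E)) := by
        rw [mul_assoc, ← nodalDeriv_eq_symm_mul hδ0 hγ1' i]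
      have h := hk
      rw [heq, map_mul, hF, mul_one] at h
      exact h
    exact exists_norm_solution_of_zpow_even σ hσσ hσO hmove hϖ0 hσϖ hσc k hval
  choose b hb using hsol
  obtain ⟨hmem, hunit⟩ := exists_criterion_of_norm_solutions 𝒪[E] σ hγ hγ1u δ.2 hδu d b hb
  exact natCard_setOf_cyclicLattice_good_eq_relIndex 𝒪[E] hγ σ d b hmem hunit

omit [UniformSpace E] [IsUniformAddGroup E] [IsNonarchimedeanLocalField E] in
/-- **THE ODD HALF: `S(τ) = ∅`.**  If some criterion scalar has the valuation of an ODD power of `ϖ` (`|d_i f′(γ_i)| = |ϖ|^{2k+1}`) and odd powers of `ϖ` are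
not values of norms `b σ(b)` (e.g. `ϖ` a uniformizer fixed by `σ`, `σ` valuation-preserving), then no `a` is GOOD (★ `valuation_criterion_mul_norm_eq_one`) and the
count is `0` (★ O8a-4). [cite: Jacobowitz1962, §7 Thm. 7.1] [cite: Rogawski1990, §4.9 Lemma 4.9.3 p. 56] -/
theorem ncard_setOf_selfDual_cyclic_eq_zero_of_odd (hσσ : ∀ x, σ (σ x) = x) (hσO : ∀ x : 𝒪[E], σ x ∈ 𝒪[E])
    (htr : ∃ b : 𝒪[E], (b : E) + σ b = 1) (hnorm : ∀ u : 𝒪[E], IsUnit u → σ u = u → ∃ t : 𝒪[E], (t : E) * σ t = u)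
    (hσv : ∀ x, valuation E (σ x) = valuation E x) {ϖ : E}
    (hϖodd : ∀ b : E, ∀ k : ℤ, valuation E (b * σ b) * valuation E (ϖ ^ (2 * k + 1)) ≠ 1)
    (J : GL (Fin n) E) (hJ : J ∈ glInt n E) (hJh : ((J : Matrix (Fin n) (Fin n) E).map σ)ᵀ = J)
    (P : GL (Fin n) E) (d : Fin n → E) (hP : formCongr σ P (J : Matrix (Fin n) (Fin n) E) = diagonal d)
    {γ : Fin n → E} (hγ : ∀ i, γ i ∈ 𝒪[E]) (hinj : Function.Injective γ) (hσγ : ∀ i, σ (γ i) = (γ i)⁻¹)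
    {r : (𝒪[E])[X]} (hr : ∀ i, (r.map (𝒪[E]).subtype).eval (γ i) * γ i = 1)
    {i : Fin n} {k : ℤ} (hi : valuation E (d i * ∏ j ∈ univ.erase i, (γ i - γ j)) = valuation E (ϖ ^ (2 * k + 1))) :
    {Λ : Submodule 𝒪[E] (Fin n → E) |
        (∃ u ∈ unitaryGroupOfForm σ (J : Matrix (Fin n) (Fin n) E), Λ = Submodule.span 𝒪[E] (Set.range ((u : Matrix (Fin n) (Fin n) E))ᵀ)) ∧
        ∃ w : Fin n → E, Λ = Submodule.span 𝒪[E] (Set.range fun j : Fin n =>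
          ((P : Matrix (Fin n) (Fin n) E) * diagonal γ * ((P⁻¹ : GL (Fin n) E) : Matrix (Fin n) (Fin n) E)) ^ (j : ℕ) *ᵥ w)}.ncard = 0 := by
  classical
  rw [ncard_setOf_selfDual_cyclic_eq_natCard_good σ hσσ hσO htr hnorm hσv J hJ hJh P d hP hγ hinj hσγ hr]
  haveI : IsEmpty {M : Submodule 𝒪[E] (Fin n → E) //
      ∃ a : Fin n → E,
        ((fun i => d i * a i * σ (a i) * ∏ j ∈ univ.erase i, (γ i - γ j)) ∈ Submodule.span 𝒪[E] (Set.range fun j : Fin n => fun i => γ i ^ (j : ℕ)) ∧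
          ∀ i, ∃ y ∈ 𝒪[E], y * (d i * a i * σ (a i) * ∏ j ∈ univ.erase i, (γ i - γ j)) = 1) ∧
        M = Submodule.span 𝒪[E] (Set.range fun j : Fin n => fun i => γ i ^ (j : ℕ) * a i)} := by
    refine ⟨fun ⟨M, a, ⟨hmem, hunit⟩, _⟩ => ?_⟩
    have h1 := valuation_criterion_mul_norm_eq_one σ hγ d a hmem hunit i
    rw [hi, mul_comm] at h1
    exact hϖodd (a i) k h1
  exact Nat.card_of_isEmpty

end Parity

end Literature.NumberTheory.Automorphic
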